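import Literature.Analysis.Fourier.SelbergMajorantsFourier
import Literature.NumberTheory.LFunctions.WeilExplicitContinuous
import Literature.NumberTheory.LFunctions.WeilMellinInversion
import Literature.NumberTheory.LFunctions.WeilArchimedeanPositivityProofs
import Mathlib.Analysis.Fourier.Inversion
import HarnessLib

/-!
# A smoothed Selberg minorant as a Weil test function

Topic `Literature/NumberTheory/LFunctions`. Everything in this file is PROVED (no definitions, no
named facts).

In the normalisation of `Literature.NumberTheory.LFunctions.weilMellin` the transform of a test
`g` on the critical line is the Fourier transform `ĝ(1/2 + it) = ∫ g(x) e^{ixt} dx`, so a test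
supported in `[-L, L]` has a transform of exponential type `L`, i.e. of "bandwidth" `L/2π` in the
`e^{-2πixξ}` normalisation of Mathlib's `𝓕` and of Selberg's extremal functions
(`Literature.Analysis.Fourier.selbergMinorant Δ a b`: entire of type `2πΔ`, `F₋ ≤ 𝟙_{[a,b]}` on `ℝ`,
`∫ F₋ = (b - a) - 1/Δ`, `𝓕 F₋ = 0` off `[-Δ, Δ]`; J. D. Vaaler, Bull. AMS 12 (1985), Thm. 8).

* `exists_kernel_of_fourier_eq_zero` — **Paley–Wiener synthesis in Weil vocabulary**: a continuous
  integrable `f : ℝ → ℂ` whose Fourier transform vanishes for `|ξ| ≥ Δ` is the critical-line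
  transform `f(u) = k̂(1/2 + iu)` of the continuous kernel `k(x) = (1/2π) 𝓕f(x/2π)`, supported in
  `[-2πΔ, 2πΔ]` (Fourier inversion, `Continuous.fourierInv_fourier_eq`).
* `isWeilTest_weilConv_moll_weilReflect`, `tsupport_weilConv_moll_weilReflect_subset`,
  `weilMellin_weilConv_moll_weilReflect_half` — smoothing such a kernel by `φ_n ⋆ φ̃_n`
  (`WeilContinuous.moll n`, radius `1/(n+1)`) gives a genuine Weil test (smooth, compact support
  enlarged by `2/(n+1)`) whose transform on the line is `k̂ · |φ̂_n|²`, `0 ≤ |φ̂_n|² ≤ 1`.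
* `exists_isWeilTest_weilMellin_le_indicator` — **the smoothed Selberg minorant**: for `L > 0` and
  every length `w > 2π/L` there is a Weil test `g` supported in `[-L, L]` with REAL transform
  `ĝ(1/2 + it) ≤ 𝟙_{[0,w]}(t)` on the whole line and `Re g(0) > 0` (equivalently
  `∫ ĝ(1/2+it) dt = 2π g(0) > 0`): take `F₋` for `[0, w]` with `1/w < Δ < L/2π` (so `∫ F₋ = w - 1/Δ > 0`),
  synthesise, smooth, and let `n → ∞` (`φ̂_n → 1`, dominated convergence). The threshold `w > 2π/L`
  is sharp (Selberg). Paired with a positive measure `μ` representing a functional on the Weil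
  tests supported in `[-L, L]`, such a `g` bounds `μ[T, T+w]` from below by the functional at the
  modulated test `g(x)e^{-iTx}`.

## References

* [Vaaler1985] J. D. Vaaler, *Some extremal functions in Fourier analysis*, Bull. AMS 12 (1985),
  Thm. 8. [cite: Vaaler1985, Thm. 8]
* H. L. Montgomery, *Ten lectures on the interface between analytic number theory and harmonic
  analysis*, CBMS 84 (1994), Ch. 1 §2 (Selberg's functions and their use against measures).
-/

noncomputable section

open Complex Filter Set MeasureTheory
open scoped Real Topology FourierTransform

namespace Literature.NumberTheory.LFunctions

open Literature.Analysis.Fourier WeilContinuous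

/-! ## Paley–Wiener synthesis: a band-limited profile is the transform of a compact kernel -/

/-- **Synthesis of a band-limited profile.** If `f : ℝ → ℂ` is continuous and integrable and its
Fourier transform vanishes for `|ξ| ≥ Δ`, then `k(x) = (1/2π) 𝓕f(x/2π)` is a continuous kernel
supported in `[-2πΔ, 2πΔ]` with `k̂(1/2 + iu) = f(u)` for all real `u` (Fourier inversion).
[folklore] -/
theorem exists_kernel_of_fourier_eq_zero {f : ℝ → ℂ} (hfc : Continuous f) (hfi : Integrable f)
    {Δ : ℝ} (hsupp : ∀ ξ : ℝ, Δ ≤ |ξ| → 𝓕 f ξ = 0) :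
    ∃ k : ℝ → ℂ, Continuous k ∧ HasCompactSupport k ∧
      tsupport k ⊆ Icc (-(2 * π * Δ)) (2 * π * Δ) ∧
      ∀ u : ℝ, weilMellin k (1 / 2 + u * I) = f u := by
  set Φ : ℝ → ℂ := 𝓕 f with hΦdef
  have hΦc : Continuous Φ :=
    VectorFourier.fourierIntegral_continuous Real.continuous_fourierChar continuous_inner hfi
  have hΦsupp : HasCompactSupport Φ := by
    refine HasCompactSupport.intro (isCompact_Icc (a := -Δ) (b := Δ)) fun ξ hξ ↦ hsupp ξ ?_
    rw [mem_Icc, not_and_or, not_le, not_le] at hξ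
    rcases hξ with h | h
    · exact le_trans (by linarith) (neg_le_abs ξ)
    · exact le_trans h.le (le_abs_self ξ)
  have hΦi : Integrable Φ := hΦc.integrable_of_hasCompactSupport hΦsupp
  -- the kernel `k(x) = (1/2π) Φ(x/2π)`
  set k : ℝ → ℂ := fun x ↦ (1 / (2 * π) : ℂ) * Φ (x / (2 * π)) with hkdef
  have hkc : Continuous k := continuous_const.mul (hΦc.comp (continuous_id.div_const _))
  have hk0 : ∀ x : ℝ, 2 * π * Δ ≤ |x| → k x = 0 := by
    intro x hx
    have : Δ ≤ |x / (2 * π)| := by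
      rw [abs_div, abs_of_pos (by positivity : (0 : ℝ) < 2 * π), le_div_iff₀ (by positivity)]
      linarith
    simp only [hkdef, hsupp _ this, mul_zero]
  have hks : HasCompactSupport k := by
    refine HasCompactSupport.intro (isCompact_Icc (a := -(2 * π * Δ)) (b := 2 * π * Δ))
      fun x hx ↦ hk0 x ?_
    rw [mem_Icc, not_and_or, not_le, not_le] at hx
    rcases hx with h | h
    · have : x ≤ |x| ∧ -x ≤ |x| := ⟨le_abs_self x, neg_le_abs x⟩
      rcases le_or_gt 0 x with h0 | h0
      · rw [abs_of_nonneg h0]; nlinarith [Real.pi_pos]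
      · rw [abs_of_neg h0]; linarith
    · rcases le_or_gt 0 x with h0 | h0
      · rw [abs_of_nonneg h0]; linarith
      · rw [abs_of_neg h0]; nlinarith [Real.pi_pos]
  have hkt : tsupport k ⊆ Icc (-(2 * π * Δ)) (2 * π * Δ) := by
    refine closure_minimal (fun x hx ↦ ?_) isClosed_Icc
    rw [Function.mem_support] at hx
    by_contra hmem
    rw [mem_Icc, not_and_or, not_le, not_le] at hmem
    refine hx (hk0 x ?_)
    rcases hmem with h | h
    · rcases le_or_gt 0 x with h0 | h0
      · rw [abs_of_nonneg h0]; nlinarith [Real.pi_pos]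
      · rw [abs_of_neg h0]; linarith
    · rcases le_or_gt 0 x with h0 | h0
      · rw [abs_of_nonneg h0]; linarith
      · rw [abs_of_neg h0]; nlinarith [Real.pi_pos]
  -- `k̂(1/2 + iu) = f(u)` by Fourier inversion
  have hline : ∀ u : ℝ, weilMellin k (1 / 2 + u * I) = f u := by
    intro u
    have hW : weilMellin k (1 / 2 + u * I) = ∫ x : ℝ, k x * cexp (u * I * x) := by
      unfold weilMellin
      congr 1 with x
      congr 2
      ring
    rw [hW]
    have h1 : (fun x : ℝ ↦ k x * cexp (u * I * x)) =
        fun x : ℝ ↦ (fun y : ℝ ↦ (1 / (2 * π) : ℂ) *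
          (cexp (↑(2 * π * (y * u)) * I) * Φ y)) (x / (2 * π)) := by
      funext x
      simp only [hkdef]
      have : cexp (u * I * x) = cexp (↑(2 * π * (x / (2 * π) * u)) * I) := by
        congr 1
        have hπ : (2 * π : ℝ) ≠ 0 := by positivity
        field_simp
        push_cast
        ring
      rw [this]; ring
    rw [h1, Measure.integral_comp_div (fun y : ℝ ↦ (1 / (2 * π) : ℂ) *
      (cexp (↑(2 * π * (y * u)) * I) * Φ y)) (2 * π)]
    rw [MeasureTheory.integral_const_mul, abs_of_pos (by positivity : (0 : ℝ) < 2 * π)]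
    have hinv : 𝓕⁻ Φ u = ∫ y : ℝ, cexp (↑(2 * π * (y * u)) * I) * Φ y := by
      rw [Real.fourierInv_eq']
      refine integral_congr_ae (Eventually.of_forall fun y ↦ ?_)
      simp [smul_eq_mul, mul_comm y u]
    have hFI : 𝓕⁻ Φ = f := by
      rw [hΦdef]; exact hfc.fourierInv_fourier_eq hfi hΦi
    rw [← hinv, hFI]
    simp only [real_smul]
    have hπ : ((2 * π : ℝ) : ℂ) ≠ 0 := by exact_mod_cast (by positivity : (2 * π : ℝ) ≠ 0)
    field_simp
    push_cast
    ring
  exact ⟨k, hkc, hks, hkt, hline⟩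

/-! ## Smoothing a continuous compactly supported kernel by `φ_n ⋆ φ̃_n` -/

variable {k : ℝ → ℂ}

/-- `(k ⋆ φ_n) ⋆ φ̃_n` is a Weil test for `k` continuous of compact support. [folklore] -/
theorem isWeilTest_weilConv_moll_weilReflect (hkc : Continuous k) (hks : HasCompactSupport k)
    (n : ℕ) : IsWeilTest (weilConv (weilConv k (moll n)) (weilReflect (moll n))) :=
  (isWeilTest_weilConv_moll hkc hks n).weilConv (isWeilTest_moll n).weilReflect

/-- The mollifier `φ_n` is supported in `[-1/(n+1), 1/(n+1)]`. [folklore] -/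
theorem tsupport_moll_subset (n : ℕ) :
    tsupport (moll n) ⊆ Icc (-(1 / ((n : ℝ) + 1))) (1 / ((n : ℝ) + 1)) := by
  refine closure_minimal (fun x hx ↦ ?_) isClosed_Icc
  rw [Function.mem_support] at hx
  by_contra hmem
  refine hx (moll_eq_zero ?_)
  rw [bump_rOut]
  rw [mem_Icc, not_and_or, not_le, not_le] at hmem
  rcases hmem with h | h
  · rcases le_or_gt 0 x with h0 | h0
    · rw [abs_of_nonneg h0]
      have : (0 : ℝ) < 1 / ((n : ℝ) + 1) := by positivity
      linarith
    · rw [abs_of_neg h0]; linarith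
  · rcases le_or_gt 0 x with h0 | h0
    · rw [abs_of_nonneg h0]; linarith
    · rw [abs_of_neg h0]
      have : (0 : ℝ) < 1 / ((n : ℝ) + 1) := by positivity
      linarith

/-- Smoothing enlarges the support by at most `2/(n+1)`: if `tsupport k ⊆ [-a, a]` then
`tsupport ((k ⋆ φ_n) ⋆ φ̃_n) ⊆ [-(a + 2/(n+1)), a + 2/(n+1)]`. [folklore] -/
theorem tsupport_weilConv_moll_weilReflect_subset (hks : HasCompactSupport k) {a : ℝ}
    (hkt : tsupport k ⊆ Icc (-a) a) (n : ℕ) :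
    tsupport (weilConv (weilConv k (moll n)) (weilReflect (moll n))) ⊆
      Icc (-(a + 2 / ((n : ℝ) + 1))) (a + 2 / ((n : ℝ) + 1)) := by
  have h1 : HasCompactSupport (weilConv k (moll n)) := by
    rw [weilConv_eq_convolution_real]
    exact HasCompactSupport.convolution (L := ContinuousLinearMap.mul ℝ ℂ) hks (hasCompactSupport_moll n)
  refine (tsupport_weilConv_subset h1).trans ?_
  have h2 := tsupport_weilConv_subset (h := moll n) hks
  have h3 : tsupport (weilReflect (moll n)) ⊆ Icc (-(1 / ((n : ℝ) + 1))) (1 / ((n : ℝ) + 1)) := by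
    rw [tsupport_weilReflect]
    intro x hx
    have hx' : -x ∈ tsupport (moll n) := by simpa using hx
    have := tsupport_moll_subset n hx'
    simp only [mem_Icc] at this ⊢
    constructor <;> linarith [this.1, this.2]
  rintro x ⟨y, hy, v, hv, rfl⟩
  obtain ⟨p, hp, q, hq, rfl⟩ := h2 hy
  have hp' := hkt hp
  have hq' := tsupport_moll_subset n hq
  have hv' := h3 hv
  simp only [mem_Icc] at hp' hq' hv' ⊢
  have e : (2 : ℝ) / ((n : ℝ) + 1) = 1 / ((n : ℝ) + 1) + 1 / ((n : ℝ) + 1) := by ring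
  rw [e]
  constructor <;> linarith [hp'.1, hp'.2, hq'.1, hq'.2, hv'.1, hv'.2]

/-- On the critical line the transform of `(k ⋆ φ_n) ⋆ φ̃_n` is `k̂ · |φ̂_n|²`
(`(φ̃_n)^(s) = conj φ̂_n(1 - conj s)` and `1 - conj s = s` on `Re s = 1/2`). [folklore] -/
theorem weilMellin_weilConv_moll_weilReflect_half (hkc : Continuous k) (hks : HasCompactSupport k)
    (n : ℕ) (u : ℝ) :
    weilMellin (weilConv (weilConv k (moll n)) (weilReflect (moll n))) (1 / 2 + u * I) =
      weilMellin k (1 / 2 + u * I) *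
        ((‖weilMellin (moll n) (1 / 2 + u * I)‖ ^ 2 : ℝ) : ℂ) := by
  have hk1 : IsWeilTest (weilConv k (moll n)) := isWeilTest_weilConv_moll hkc hks n
  have hm : IsWeilTest (weilReflect (moll n)) := (isWeilTest_moll n).weilReflect
  rw [weilMellin_weilConv_holds hk1.1.continuous hk1.2 hm.1.continuous hm.2,
    weilMellin_weilConv_moll hkc hks n, weilMellin_weilReflect_holds]
  have hs : 1 - (starRingEnd ℂ) (1 / 2 + (u : ℂ) * I) = 1 / 2 + u * I := by
    apply Complex.ext
    · simp; norm_num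
    · simp
  rw [hs, mul_assoc, Complex.mul_conj, Complex.normSq_eq_norm_sq]

/-! ## The smoothed Selberg minorant -/

/-- **A Weil test whose transform minorises an interval.** For `L > 0` and `w > 2π/L` there is a
Weil test `g` supported in `[-L, L]` with `Re g(0) > 0` whose transform on the critical line is
real and satisfies `ĝ(1/2 + it) ≤ 𝟙_{[0, w]}(t)` for every real `t`: a smoothing of the inverse
transform of Selberg's minorant `F₋` of `[0, w]` of bandwidth `Δ ∈ (1/w, L/2π)`, whose integral
`w - 1/Δ` is positive. The threshold `2π/L` is sharp. [cite: Vaaler1985, Thm. 8] -/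
theorem exists_isWeilTest_weilMellin_le_indicator {L w : ℝ} (hL : 0 < L) (hw : 2 * π / L < w) :
    ∃ g : ℝ → ℂ, IsWeilTest g ∧ tsupport g ⊆ Icc (-L) L ∧ 0 < (g 0).re ∧
      ∀ t : ℝ, (weilMellin g (1 / 2 + t * I)).im = 0 ∧
        (weilMellin g (1 / 2 + t * I)).re ≤ (Icc 0 w).indicator (fun _ ↦ (1 : ℝ)) t := by
  -- the bandwidth
  have hw0 : 0 < w := lt_trans (by positivity) hw
  set Δ : ℝ := (1 / w + L / (2 * π)) / 2 with hΔdef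
  have h1w : 1 / w < L / (2 * π) := by
    rw [div_lt_div_iff₀ hw0 (by positivity)]
    rw [div_lt_iff₀ hL] at hw
    linarith
  have hΔ1 : 1 / w < Δ := by rw [hΔdef]; linarith
  have hΔ2 : Δ < L / (2 * π) := by rw [hΔdef]; linarith
  have hΔ : 0 < Δ := lt_trans (by positivity) hΔ1
  have hΔL : 2 * π * Δ < L := by
    rwa [lt_div_iff₀ (by positivity), mul_comm] at hΔ2
  have hmass : 0 < w - 1 / Δ := by
    have : 1 / Δ < w := by
      rw [div_lt_iff₀ hΔ]; rw [div_lt_iff₀ hw0] at hΔ1; linarith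
    linarith
  -- Selberg's minorant of `[0, w]` and its synthesis
  set Fr : ℝ → ℝ := selbergMinorantReal Δ 0 w with hFr
  set f : ℝ → ℂ := fun x : ℝ ↦ selbergMinorant Δ 0 w x with hf
  have hfr : ∀ x : ℝ, f x = (Fr x : ℂ) := fun x ↦ selbergMinorant_ofReal Δ 0 w x
  have hfc : Continuous f := by
    have : f = fun x : ℝ ↦ ((Fr x : ℝ) : ℂ) := funext hfr
    rw [this]
    exact Complex.continuous_ofReal.comp (continuous_selbergMinorantReal Δ 0 w)
  have hfi : Integrable f := integrable_selbergMinorant_ofReal hΔ hw0.le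
  obtain ⟨k, hkc, hks, hkt, hline⟩ := exists_kernel_of_fourier_eq_zero hfc hfi
    (fun ξ hξ ↦ fourier_selbergMinorant_eq_zero hΔ hw0.le hξ)
  -- the smoothed tests `g_n = (k ⋆ φ_n) ⋆ φ̃_n` and their transforms `Fr · |φ̂_n|²`
  set G : ℕ → ℝ → ℂ := fun n ↦ weilConv (weilConv k (moll n)) (weilReflect (moll n)) with hG
  set P : ℕ → ℝ → ℝ := fun n t ↦ Fr t * ‖weilMellin (moll n) (1 / 2 + t * I)‖ ^ 2 with hP
  have hGline : ∀ (n : ℕ) (t : ℝ), weilMellin (G n) (1 / 2 + t * I) = (P n t : ℂ) := by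
    intro n t
    simp only [hG, hP]
    rw [weilMellin_weilConv_moll_weilReflect_half hkc hks n t, hline t, hfr t]
    push_cast
    ring
  -- `2π g_n(0) = ∫ P_n`
  have hG0 : ∀ n : ℕ, 2 * π * G n 0 = ((∫ t : ℝ, P n t : ℝ) : ℂ) := by
    intro n
    have h := integral_weilMellin_vertical (isWeilTest_weilConv_moll_weilReflect hkc hks n) (1 / 2)
    have e : (((1 / 2 : ℝ)) : ℂ) = 1 / 2 := by push_cast; ring
    simp_rw [e] at h
    rw [← h, ← integral_complex_ofReal]
    exact integral_congr_ae (Eventually.of_forall fun t ↦ hGline n t)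
  -- `∫ P_n → ∫ Fr = w - 1/Δ > 0` (dominated convergence, `φ̂_n → 1`, `|φ̂_n| ≤ 1`)
  have hlim : Tendsto (fun n ↦ ∫ t : ℝ, P n t) atTop (𝓝 (∫ t : ℝ, Fr t)) := by
    refine tendsto_integral_of_dominated_convergence (fun t ↦ |Fr t|) (fun n ↦ ?_)
      (integrable_selbergMinorantReal hΔ hw0.le).abs (fun n ↦ Eventually.of_forall fun t ↦ ?_)
      (Eventually.of_forall fun t ↦ ?_)
    · refine Continuous.aestronglyMeasurable ?_
      simp only [hP]
      refine (continuous_selbergMinorantReal Δ 0 w).mul ?_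
      refine (Continuous.norm ?_).pow 2
      exact (continuous_weilMellin (continuous_moll n) (hasCompactSupport_moll n)).comp
        (by fun_prop)
    · simp only [hP, Real.norm_eq_abs, abs_mul, abs_pow, abs_norm]
      have h1 : ‖weilMellin (moll n) (1 / 2 + t * I)‖ ^ 2 ≤ 1 := by
        have := norm_weilMellin_moll_half_le n t
        exact pow_le_one₀ (norm_nonneg _) this
      calc |Fr t| * ‖weilMellin (moll n) (1 / 2 + ↑t * I)‖ ^ 2 ≤ |Fr t| * 1 := by
            gcongr
        _ = |Fr t| := mul_one _
    · have h := ((tendsto_weilMellin_moll (1 / 2 + t * I)).norm).pow 2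
      simp only [norm_one, one_pow] at h
      have := h.const_mul (Fr t)
      simpa [hP] using this
  have hint : ∫ t : ℝ, Fr t = w - 1 / Δ := by
    have := integral_selbergMinorantReal hΔ hw0.le (a := 0) (b := w)
    simpa [hFr] using this
  rw [hint] at hlim
  have hev1 : ∀ᶠ n : ℕ in atTop, 0 < ∫ t : ℝ, P n t := hlim.eventually_const_lt hmass
  -- the support fits for `n` large
  have hev2 : ∀ᶠ n : ℕ in atTop, 2 / ((n : ℝ) + 1) < L - 2 * π * Δ := by
    have h : Tendsto (fun n : ℕ ↦ 2 * (1 / ((n : ℝ) + 1))) atTop (𝓝 (2 * 0)) :=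
      tendsto_one_div_add_atTop_nhds_zero_nat.const_mul 2
    rw [mul_zero] at h
    filter_upwards [h.eventually_lt_const (by linarith : (0 : ℝ) < L - 2 * π * Δ)] with n hn
    have e : (2 : ℝ) / ((n : ℝ) + 1) = 2 * (1 / ((n : ℝ) + 1)) := by ring
    rwa [e]
  obtain ⟨n, hn1, hn2⟩ := (hev1.and hev2).exists
  -- the witness
  refine ⟨G n, isWeilTest_weilConv_moll_weilReflect hkc hks n, ?_, ?_, fun t ↦ ?_⟩
  · refine (tsupport_weilConv_moll_weilReflect_subset hks hkt n).trans (Icc_subset_Icc ?_ ?_) <;>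
      linarith
  · have h := hG0 n
    have hπ : (0 : ℝ) < 2 * π := by positivity
    have e : (G n 0).re = (∫ t : ℝ, P n t) / (2 * π) := by
      have hπC : (π : ℂ) ≠ 0 := Complex.ofReal_ne_zero.2 Real.pi_ne_zero
      have h2 : G n 0 = (1 / (2 * π) : ℂ) * (2 * π * G n 0) := by field_simp
      rw [h2, h, show (1 / (2 * π) : ℂ) = ((1 / (2 * π) : ℝ) : ℂ) by push_cast; ring,
        ← Complex.ofReal_mul, Complex.ofReal_re]
      ring
    rw [e]
    positivity
  · rw [hGline n t, Complex.ofReal_im, Complex.ofReal_re]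
    refine ⟨rfl, ?_⟩
    simp only [hP]
    have hF := selbergMinorantReal_le_indicator_Icc hΔ 0 w t
    have h0 : 0 ≤ ‖weilMellin (moll n) (1 / 2 + t * I)‖ ^ 2 := by positivity
    have h1 : ‖weilMellin (moll n) (1 / 2 + t * I)‖ ^ 2 ≤ 1 :=
      pow_le_one₀ (norm_nonneg _) (norm_weilMellin_moll_half_le n t)
    by_cases ht : t ∈ Icc 0 w
    · rw [indicator_of_mem ht] at hF ⊢
      rcases le_or_gt 0 (Fr t) with hpos | hneg
      · calc Fr t * ‖weilMellin (moll n) (1 / 2 + ↑t * I)‖ ^ 2 ≤ Fr t * 1 := by gcongr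
          _ ≤ 1 := by linarith
      · nlinarith
    · rw [indicator_of_notMem ht] at hF ⊢
      nlinarith

end Literature.NumberTheory.LFunctions

end
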